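import Literature.NumberTheory.Automorphic.CompactCoreCentralizerNonarch
import HarnessLib

/-!
# Canonical orbital measure families EXIST: the `∃ m, m.IsCanonical P ν` producer, compact-core plumbing, and the instances
# `GL_N(E_w)` ∕ closed subgroups of `GL_N(E_w)` at a finite place
(Rogawski (1990), §4.3 (4.3.1) p. 43 «the orbital integrals are defined using compatible measures on `H_{γ′}` and `G_γ`», §1.7 p. 6;
Deitmar–Echterhoff (2014), Thm. 1.5.3; Tits (1979), §3.9 «`T(k)` has a unique maximal compact subgroup, which is open»)

Topic `NumberTheory/Automorphic`; namespace `Literature.NumberTheory.Automorphic`. THEOREMS ONLY (no definition, no instance, no notation, no named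
fact, no `sorry`). Cell `pub/hodgecm-mathlib`, programme P3a, road «D-N6s», brick «D-N6s-cf — CANONICAL FAMILIES EXIST» part (A) (LEAD F0P3a-plan (g8)
T7-55). WHY: the N6 letter ★ `LocalTransferExplicit` (`Rogawski1990/LocalTransferUnitExplicitFactor`) is `∀ v, ∃ mH mG, (mH.IsCanonical … ∧ mG.IsCanonical …) ∧ …`
— an `∃` over CANONICAL orbital measure families (★ `OrbitalMeasureFamily.IsCanonical`, `OrbitalMeasureCanonical` :134: at every `P`-class `c` the member
`m c` IS `dν ∕ dt`, `t` THE Haar measure on `Z(γ_c)` with mass one on its compact core); the bricks that pay the transfer clause work for GIVEN canonical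
`(mH, mG)`. This file produces the witnesses:

* §1 **`OrbitalMeasureFamily.exists_isCanonical`** (generic `G`): if at every `γ` with `P γ` the centraliser `Z(γ)` carries a Haar measure, inversion
  invariant, with mass `1` on `compactCore Z(γ)`, then `∃ m : OrbitalMeasureFamily G, m.IsCanonical P ν` (choice at the representatives `out c`; the
  predicate constrains nothing off `P`, so the family is `0` there).
* §2 compact-core plumbing (generic topological groups): `compactCore_eq_preimage_of_isClosedEmbedding` (`compactCore Z = f⁻¹(compactCore Z′)` for a
  closed embedding `f : Z →* Z′`), `compactCore_coe_eq_preimage` (closed subgroups), `compactCore_prod`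
  (`compactCore (Z₁ × Z₂) = compactCore Z₁ ×ˢ compactCore Z₂`), `exists_isHaarMeasure_compactCore_eq_one_of_continuousMulEquiv` (the `∃ t` clause
  transports along `≃ₜ*`, ★ `image_compactCore`).
* §3 **closed subgroups `U ≤ GL_N(E_w)`** (`E` a number field, `w` a finite place; the one-place models of the local unitary groups ★ `localNonsplitEquiv`
  are such): for `γ ∈ U` with separable characteristic polynomial, `Z_U(γ) ↪ Z_{GL}(γ)` is a closed embedding, so by §2 and ★ g0
  (`CompactCoreCentralizerNonarch`: `isCompact_∕isOpen_compactCore_centralizer`, `mul_comm_of_mem_centralizer_of_charpoly_separable`) the compact core of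
  `Z_U(γ)` is compact and open and `Z_U(γ)` is commutative — `isCompact_compactCore_centralizer_subgroup`, `isOpen_compactCore_centralizer_subgroup`,
  `mul_comm_centralizer_of_subgroup` — whence **`exists_isHaarMeasure_compactCore_centralizer_subgroup_eq_one`** (★ `exists_isHaarMeasure_compactCore_eq_one`).
* §4 the producers: **`exists_isCanonical_gl_adicCompletion`** (`G = GL_N(E_w)`, `P γ :=` separable characteristic polynomial; §1 + ★ g0
  `exists_isHaarMeasure_compactCore_centralizer_eq_one`) and **`exists_isCanonical_of_isClosed`** (`G = U` a closed subgroup of `GL_N(E_w)`; §1 + §3).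
The CM dress (`(cmDatum L 3 H′).Local v` at split ∕ non-split `v` through ★ `localSplitEquiv` ∕ ★ `localNonsplitEquiv` and ★ `IsCanonical.transport`; the
`H`-side product) is part (B). Archimedean places are out of scope (Haar-null compact cores, `OrbitalMeasureCanonical` :131). HC_CM is proved only modulo
the printed citations until rung 0 closes; this file moves no count.

## References
* [Rogawski1990] J. D. Rogawski, *Automorphic Representations of Unitary Groups in Three Variables*, Ann. of Math. Stud. 123 (1990), §4.3 (4.3.1) p. 43,
  §1.7 p. 6.
* [DeitmarEchterhoff2014] A. Deitmar, S. Echterhoff, *Principles of Harmonic Analysis*, 2nd ed. (2014), Thm. 1.5.3.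
* [Tits1979] J. Tits, *Reductive groups over local fields*, Proc. Sympos. Pure Math. 33.1 (1979), §3.9.
* [PlatonovRapinchuk1994] V. Platonov, A. Rapinchuk, *Algebraic Groups and Number Theory* (1994), §3.3.
* [BourbakiGT1] N. Bourbaki, *General Topology*, Ch. III §2.
-/

set_option autoImplicit false

noncomputable section

open MeasureTheory Measure Set Filter Topology NumberField IsDedekindDomain
open Literature.MeasureTheory.Group
open scoped ENNReal NNReal Matrix MatrixGroups

namespace Literature.NumberTheory.Automorphic

/-! ## §1 The producer: canonical families exist as soon as the normalised torus measures do -/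

section Exists

variable {G : Type*} [Group G] [TopologicalSpace G] [IsTopologicalGroup G] [LocallyCompactSpace G] [SecondCountableTopology G]
  [T2Space G] [MeasurableSpace G] [BorelSpace G]
  [∀ γ : G, MeasurableSpace (G ⧸ Subgroup.centralizer ({γ} : Set G))]
  [∀ γ : G, BorelSpace (G ⧸ Subgroup.centralizer ({γ} : Set G))]

/-- **Canonical orbital measure families EXIST** as soon as, at every `γ` with `P γ`, the centraliser `Z(γ)` carries a Haar measure, inversion
invariant, with mass one on its compact core: take `m c := dν ∕ dt_c` (★ `quotientMeasure`) for a chosen such `t_c` at the representative `γ_c = out c`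
of every `P`-class, and `0` at the other classes (★ `OrbitalMeasureFamily.IsCanonical` constrains nothing there). With ★ `IsCanonical.eq_of_isCanonical`
the family is unique on the `P`-classes. [cite: Rogawski1990, §4.3 (4.3.1) p. 43] [cite: DeitmarEchterhoff2014, Thm. 1.5.3] -/
theorem OrbitalMeasureFamily.exists_isCanonical (P : G → Prop) (ν : Measure G) [IsFiniteMeasureOnCompacts ν] [ν.IsMulRightInvariant]
    (ht : ∀ γ : G, P γ → ∃ t : Measure (Subgroup.centralizer ({γ} : Set G)),
      t.IsHaarMeasure ∧ t.IsInvInvariant ∧ t (compactCore (Subgroup.centralizer ({γ} : Set G))) = 1) :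
    ∃ m : OrbitalMeasureFamily G, m.IsCanonical P ν := by
  classical
  refine ⟨fun c => if h : P (Quotient.out c) then
      (by
        haveI := (ht _ h).choose_spec.1
        haveI := (ht _ h).choose_spec.2.1
        exact quotientMeasure (Subgroup.centralizer ({(Quotient.out c : G)} : Set G)) (ht _ h).choose
          (isClosed_coe_centralizer_singleton (Quotient.out c)) ν)
      else 0, fun c hc => ?_⟩
  refine ⟨(ht _ hc).choose, (ht _ hc).choose_spec.1, (ht _ hc).choose_spec.2.1, (ht _ hc).choose_spec.2.2, ?_⟩
  simp only [dif_pos hc]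

end Exists

/-! ## §2 Compact-core plumbing: closed embeddings, closed subgroups, products, transport of the `∃ t` clause -/

section Plumbing

variable {Z Z' : Type*} [Group Z] [Group Z'] [TopologicalSpace Z] [TopologicalSpace Z']

/-- **The compact core restricts along a closed embedding**: for a closed embedding of topological groups `f : Z →* Z′`,
`compactCore Z = f⁻¹(compactCore Z′)` (a compact subgroup maps to a compact subgroup; the preimage of a compact subgroup under a closed embedding is
a compact subgroup, Mathlib `IsClosedEmbedding.isCompact_preimage`). [cite: BourbakiGT1, Ch. III §2] [cite: Tits1979, §3.9] -/
theorem compactCore_eq_preimage_of_isClosedEmbedding (f : Z →* Z') (hf : IsClosedEmbedding f) :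
    compactCore Z = f ⁻¹' compactCore Z' := by
  ext z
  simp only [mem_preimage, mem_compactCore_iff]
  constructor
  · rintro ⟨K, hK, hz⟩
    refine ⟨K.map f, ?_, ⟨z, hz, rfl⟩⟩
    rw [Subgroup.coe_map]
    exact hK.image hf.continuous
  · rintro ⟨K', hK', hz'⟩
    exact ⟨K'.comap f, by rw [Subgroup.coe_comap]; exact hf.isCompact_preimage hK', hz'⟩

/-- **The compact core of a CLOSED subgroup `K ≤ Z` is `K ∩ compactCore Z`** (as the subset `Subtype.val⁻¹(compactCore Z)` of `↥K`).
[cite: BourbakiGT1, Ch. III §2] [cite: Tits1979, §3.9] -/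
theorem compactCore_coe_eq_preimage (K : Subgroup Z) (hK : IsClosed (K : Set Z)) :
    compactCore K = Subtype.val ⁻¹' compactCore Z :=
  compactCore_eq_preimage_of_isClosedEmbedding K.subtype hK.isClosedEmbedding_subtypeVal

/-- **The compact core of a product is the product of the compact cores** (projections and products of compact subgroups are compact subgroups).
[cite: BourbakiGT1, Ch. III §2] -/
theorem compactCore_prod [IsTopologicalGroup Z] [IsTopologicalGroup Z'] :
    compactCore (Z × Z') = compactCore Z ×ˢ compactCore Z' := by
  ext x
  simp only [mem_prod, mem_compactCore_iff]
  constructor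
  · rintro ⟨K, hK, hx⟩
    exact ⟨⟨K.map (MonoidHom.fst Z Z'), by rw [Subgroup.coe_map]; exact hK.image continuous_fst, ⟨x, hx, rfl⟩⟩,
      ⟨K.map (MonoidHom.snd Z Z'), by rw [Subgroup.coe_map]; exact hK.image continuous_snd, ⟨x, hx, rfl⟩⟩⟩
  · rintro ⟨⟨K, hK, hx⟩, ⟨K', hK', hx'⟩⟩
    exact ⟨K.prod K', by rw [Subgroup.coe_prod]; exact hK.prod hK', Subgroup.mem_prod.2 ⟨hx, hx'⟩⟩

/-- **The `∃ t` clause of ★ `IsCanonical` transports along an isomorphism of topological groups** `e : Z ≃ₜ* Z′`: the image measure `e_* t` is Haar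
(Mathlib `ContinuousMulEquiv.isHaarMeasure_map`), inversion invariant, and gives mass `1` to `compactCore Z′ = e(compactCore Z)` (★ `image_compactCore`).
[cite: DeitmarEchterhoff2014, Thm. 1.5.3] [cite: Tits1979, §3.9] -/
theorem exists_isHaarMeasure_compactCore_eq_one_of_continuousMulEquiv [IsTopologicalGroup Z] [IsTopologicalGroup Z']
    [MeasurableSpace Z] [BorelSpace Z] [MeasurableSpace Z'] [BorelSpace Z'] (e : Z ≃ₜ* Z')
    (h : ∃ t : Measure Z, t.IsHaarMeasure ∧ t.IsInvInvariant ∧ t (compactCore Z) = 1) :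
    ∃ t' : Measure Z', t'.IsHaarMeasure ∧ t'.IsInvInvariant ∧ t' (compactCore Z') = 1 := by
  obtain ⟨t, ht, hti, h1⟩ := h
  have hme : Measurable e := e.continuous.measurable
  refine ⟨t.map e, inferInstance, ⟨?_⟩, ?_⟩
  · rw [Measure.inv, Measure.map_map measurable_inv hme]
    have hcomm : (Inv.inv : Z' → Z') ∘ e = e ∘ (Inv.inv : Z → Z) := funext fun z => (map_inv e z).symm
    rw [hcomm, ← Measure.map_map hme measurable_inv]
    congr 1
    exact Measure.map_inv_eq_self t
  · have hm : (Measure.map (⇑e) t) (compactCore Z') = t ((⇑e) ⁻¹' compactCore Z') :=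
      e.toHomeomorph.toMeasurableEquiv.map_apply (compactCore Z')
    have hpre : (e : Z → Z') ⁻¹' compactCore Z' = compactCore Z := by
      rw [← image_compactCore e, e.injective.preimage_image]
    rw [hm, hpre, h1]

end Plumbing

/-! ## §3 Closed subgroups of `GL_N(E_w)`: the centraliser of a regular semisimple element has a compact open compact core -/

section ClosedSubgroup

variable {E : Type} [Field E] [NumberField E] (w : HeightOneSpectrum (𝓞 E)) {N : ℕ}
  (U : Subgroup (GL (Fin N) (w.adicCompletion E))) (hU : IsClosed (U : Set (GL (Fin N) (w.adicCompletion E)))) (γ : U)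

/-- The inclusion `Z_U(γ) →* Z_{GL_N(E_w)}(γ)` of centralisers, for `γ` in a subgroup `U ≤ GL_N(E_w)` (an element of `U` commuting with `γ` commutes with
`γ` in `GL_N(E_w)`). [folklore] -/
private theorem coe_mem_centralizer (z : Subgroup.centralizer ({γ} : Set U)) :
    ((z : U) : GL (Fin N) (w.adicCompletion E)) ∈
      Subgroup.centralizer ({(γ : GL (Fin N) (w.adicCompletion E))} : Set (GL (Fin N) (w.adicCompletion E))) := by
  rw [Subgroup.mem_centralizer_singleton_iff]
  have h := Subgroup.mem_centralizer_singleton_iff.1 z.2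
  exact congrArg Subtype.val h

include hU in
/-- **`Z_U(γ) ↪ Z_{GL}(γ)` is a closed embedding** for a closed subgroup `U ≤ GL_N(E_w)` (`Z_U(γ)` is closed in `U`, ★ `isClosed_coe_centralizer_singleton`,
and `U` is closed in `GL_N(E_w)`; Mathlib `IsClosedEmbedding.of_comp`). [cite: PlatonovRapinchuk1994, §3.3] -/
theorem isClosedEmbedding_centralizer_subgroup_codRestrict :
    IsClosedEmbedding ((U.subtype.restrict (Subgroup.centralizer ({γ} : Set U))).codRestrict
      (Subgroup.centralizer ({(γ : GL (Fin N) (w.adicCompletion E))} : Set (GL (Fin N) (w.adicCompletion E))))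
      (coe_mem_centralizer w U γ)) := by
  refine IsClosedEmbedding.of_comp IsEmbedding.subtypeVal ?_
  change IsClosedEmbedding (fun z : Subgroup.centralizer ({γ} : Set U) => ((z : U) : GL (Fin N) (w.adicCompletion E)))
  exact hU.isClosedEmbedding_subtypeVal.comp (isClosed_coe_centralizer_singleton γ).isClosedEmbedding_subtypeVal

include hU in
/-- **`compactCore Z_U(γ)` is the preimage of `compactCore Z_{GL}(γ)`** (§2 along the closed embedding). [cite: Tits1979, §3.9] -/
theorem compactCore_centralizer_subgroup_eq_preimage :
    compactCore (Subgroup.centralizer ({γ} : Set U)) =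
      ((U.subtype.restrict (Subgroup.centralizer ({γ} : Set U))).codRestrict
        (Subgroup.centralizer ({(γ : GL (Fin N) (w.adicCompletion E))} : Set (GL (Fin N) (w.adicCompletion E))))
        (coe_mem_centralizer w U γ)) ⁻¹'
      compactCore (Subgroup.centralizer ({(γ : GL (Fin N) (w.adicCompletion E))} : Set (GL (Fin N) (w.adicCompletion E)))) :=
  compactCore_eq_preimage_of_isClosedEmbedding _ (isClosedEmbedding_centralizer_subgroup_codRestrict w U hU γ)

include hU in
/-- **`compactCore Z_U(γ)` IS COMPACT** for `γ ∈ U` regular semisimple (`U` closed): the preimage of the compact `compactCore Z_{GL}(γ)` (★ g0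
`isCompact_compactCore_centralizer`) under a closed embedding. [cite: Tits1979, §3.9] [cite: PlatonovRapinchuk1994, §3.3] -/
theorem isCompact_compactCore_centralizer_subgroup
    (hγ : (((γ : GL (Fin N) (w.adicCompletion E)) : Matrix (Fin N) (Fin N) (w.adicCompletion E)).charpoly).Separable) :
    IsCompact (compactCore (Subgroup.centralizer ({γ} : Set U))) := by
  rw [compactCore_centralizer_subgroup_eq_preimage w U hU γ]
  exact (isClosedEmbedding_centralizer_subgroup_codRestrict w U hU γ).isCompact_preimage (isCompact_compactCore_centralizer w _ hγ)

include hU in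
/-- **`compactCore Z_U(γ)` IS OPEN in `Z_U(γ)`** (preimage of the open `compactCore Z_{GL}(γ)`, ★ g0 `isOpen_compactCore_centralizer`).
[cite: Tits1979, §3.9] -/
theorem isOpen_compactCore_centralizer_subgroup
    (hγ : (((γ : GL (Fin N) (w.adicCompletion E)) : Matrix (Fin N) (Fin N) (w.adicCompletion E)).charpoly).Separable) :
    IsOpen (compactCore (Subgroup.centralizer ({γ} : Set U))) := by
  rw [compactCore_centralizer_subgroup_eq_preimage w U hU γ]
  exact (isOpen_compactCore_centralizer w _ hγ).preimage (isClosedEmbedding_centralizer_subgroup_codRestrict w U hU γ).continuous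

/-- **`Z_U(γ)` is commutative** for `γ ∈ U` regular semisimple (a subgroup of the commutative `Z_{GL}(γ)`, ★ g0
`mul_comm_of_mem_centralizer_of_charpoly_separable`). [cite: Tits1979, §3.9] -/
theorem mul_comm_centralizer_of_subgroup
    (hγ : (((γ : GL (Fin N) (w.adicCompletion E)) : Matrix (Fin N) (Fin N) (w.adicCompletion E)).charpoly).Separable)
    (a b : Subgroup.centralizer ({γ} : Set U)) : a * b = b * a := by
  have h := mul_comm_of_mem_centralizer_of_charpoly_separable w (γ : GL (Fin N) (w.adicCompletion E)) hγ
    ⟨((a : U) : GL (Fin N) (w.adicCompletion E)), coe_mem_centralizer w U γ a⟩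
    ⟨((b : U) : GL (Fin N) (w.adicCompletion E)), coe_mem_centralizer w U γ b⟩
  have h' := congrArg Subtype.val h
  simp only [Subgroup.coe_mul] at h'
  exact Subtype.ext (Subtype.ext (by simpa only [Subgroup.coe_mul] using h'))

include hU in
/-- **THE NORMALISED TORUS MEASURE EXISTS on `Z_U(γ)`** for a closed subgroup `U ≤ GL_N(E_w)` and `γ ∈ U` with separable characteristic
polynomial: a Haar measure on `Z_U(γ)`, inversion invariant, with mass `1` on `compactCore Z_U(γ)` (★ `exists_isHaarMeasure_compactCore_eq_one` on the
commutative `Z_U(γ)` with its compact open compact core) — the `∃ t` clause of ★ `OrbitalMeasureFamily.IsCanonical` for the one-place models of the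
local unitary groups. [cite: Rogawski1990, §4.3 (4.3.1) p. 43] [cite: Tits1979, §3.9] -/
theorem exists_isHaarMeasure_compactCore_centralizer_subgroup_eq_one
    [MeasurableSpace (GL (Fin N) (w.adicCompletion E))] [BorelSpace (GL (Fin N) (w.adicCompletion E))]
    (hγ : (((γ : GL (Fin N) (w.adicCompletion E)) : Matrix (Fin N) (Fin N) (w.adicCompletion E)).charpoly).Separable) :
    ∃ t : Measure (Subgroup.centralizer ({γ} : Set U)),
      t.IsHaarMeasure ∧ t.IsInvInvariant ∧ t (compactCore (Subgroup.centralizer ({γ} : Set U))) = 1 := by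
  haveI := locallyCompactSpace_centralizer w (γ : GL (Fin N) (w.adicCompletion E))
  haveI : LocallyCompactSpace (Subgroup.centralizer ({γ} : Set U)) :=
    (isClosedEmbedding_centralizer_subgroup_codRestrict w U hU γ).locallyCompactSpace
  exact exists_isHaarMeasure_compactCore_eq_one (mul_comm_centralizer_of_subgroup w U γ hγ)
    (isCompact_compactCore_centralizer_subgroup w U hU γ hγ) (isOpen_compactCore_centralizer_subgroup w U hU γ hγ)

end ClosedSubgroup

/-! ## §4 The producers at a finite place: `GL_N(E_w)` and its closed subgroups -/

section Producers

variable {E : Type} [Field E] [NumberField E] (w : HeightOneSpectrum (𝓞 E)) {N : ℕ}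
  [MeasurableSpace (GL (Fin N) (w.adicCompletion E))] [BorelSpace (GL (Fin N) (w.adicCompletion E))]
  [LocallyCompactSpace (GL (Fin N) (w.adicCompletion E))] [SecondCountableTopology (GL (Fin N) (w.adicCompletion E))]

/-- **CANONICAL FAMILIES EXIST on `GL_N(E_w)`** for the regular semisimple classes (separable characteristic polynomial) and any Haar measure `ν`:
§1 with ★ g0 `exists_isHaarMeasure_compactCore_centralizer_eq_one`. [cite: Rogawski1990, §4.3 (4.3.1) p. 43] [cite: Tits1979, §3.9] -/
theorem exists_isCanonical_gl_adicCompletion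
    [∀ γ : GL (Fin N) (w.adicCompletion E),
      MeasurableSpace (GL (Fin N) (w.adicCompletion E) ⧸ Subgroup.centralizer ({γ} : Set (GL (Fin N) (w.adicCompletion E))))]
    [∀ γ : GL (Fin N) (w.adicCompletion E),
      BorelSpace (GL (Fin N) (w.adicCompletion E) ⧸ Subgroup.centralizer ({γ} : Set (GL (Fin N) (w.adicCompletion E))))]
    (ν : Measure (GL (Fin N) (w.adicCompletion E))) [IsFiniteMeasureOnCompacts ν] [ν.IsMulRightInvariant] :
    ∃ m : OrbitalMeasureFamily (GL (Fin N) (w.adicCompletion E)),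
      m.IsCanonical (fun γ : GL (Fin N) (w.adicCompletion E) =>
        (((γ : Matrix (Fin N) (Fin N) (w.adicCompletion E))).charpoly).Separable) ν :=
  OrbitalMeasureFamily.exists_isCanonical _ ν fun γ hγ => exists_isHaarMeasure_compactCore_centralizer_eq_one w γ hγ

/-- **CANONICAL FAMILIES EXIST on every CLOSED subgroup `U ≤ GL_N(E_w)`** for the classes of elements with separable characteristic polynomial and
any Haar measure `ν` on `U` (§1 + §3) — through ★ `localNonsplitEquiv` ∕ ★ `localSplitEquiv` and ★ `IsCanonical.transport` this serves the local unitary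
groups `U(H)(L⁺_v)` (part (B)). [cite: Rogawski1990, §4.3 (4.3.1) p. 43] [cite: Tits1979, §3.9] -/
theorem exists_isCanonical_of_isClosed (U : Subgroup (GL (Fin N) (w.adicCompletion E)))
    (hU : IsClosed (U : Set (GL (Fin N) (w.adicCompletion E))))
    [∀ γ : U, MeasurableSpace (U ⧸ Subgroup.centralizer ({γ} : Set U))] [∀ γ : U, BorelSpace (U ⧸ Subgroup.centralizer ({γ} : Set U))]
    (ν : Measure U) [IsFiniteMeasureOnCompacts ν] [ν.IsMulRightInvariant] :
    ∃ m : OrbitalMeasureFamily U,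
      m.IsCanonical (fun γ : U =>
        ((((γ : GL (Fin N) (w.adicCompletion E))) : Matrix (Fin N) (Fin N) (w.adicCompletion E)).charpoly).Separable) ν := by
  haveI : LocallyCompactSpace U := hU.isClosedEmbedding_subtypeVal.locallyCompactSpace
  exact OrbitalMeasureFamily.exists_isCanonical _ ν fun γ hγ =>
    exists_isHaarMeasure_compactCore_centralizer_subgroup_eq_one w U hU γ hγ

end Producers

end Literature.NumberTheory.Automorphic

end
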